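import Summits.ABC.IUTFork.Joshi.LogVolumesHullsScaling
import Summits.ABC.IUTFork.Joshi.LogVolumesHullsPadicModel

/-!
# [J-III] Thm. 9.11.1 / Cor. 9.11.1.1 ADELICALLY from per-place object-level inputs, and a `ℚ_p` inhabitant of the
# full input signature (non-vacuity of `ScalingDatum`)

K. Joshi, *Construction of Arithmetic Teichmüller Spaces III* (arXiv:2401.13508 **v4**, unrefereed; bib
`Joshi2024ATS3`), Thm. 9.11.1 p.127 l.8–32 («∏_{w ∈ 𝕍^{odd,ss}}»; proof l.56–65 «one may work with components … and
then take product over all w»), Cor. 9.11.1.1 p.128 l.42–65. Cell abc-iut, block E (rung LADDER-ABC:A2.E), seat E-t23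
(slot T-23). (1) `adelicLocusDatum`: a finite family `w ↦ ScalingDatum` (p429684) projects, place by place
(`toLocusDatum`, p429037), onto E-t4's `ATS3.AdelicLocusDatum ℓ* W` (p428048); E-t4's adelic spine then yields the
PRINTED adelic statements from per-place OBJECT-level named inputs only: `NormLogBK` ((9.9.2)–(9.9.3)),
`RootScaling scalingExponent` ((9.9.4)), and the sign convention — `HullVolumeLowerBound` being DISCHARGED at every
place by the typed Lem. 9.10.7.1 (`adelic_fundamentalEstimateVol_of_inputs`, `adelic_cor91111_of_inputs`).
(2) `padicScalingDatum`: the one-factor `ℚ_p` exhibited datum (p430954) extended by the Tate-parameter root `q^{1/2ℓ} :=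
p`, the locus norms `{p⁻¹}` and the tensor norm `p⁻¹`: ALL three input Props of p429684 HOLD there
(`padicScalingDatum_inputs`), so the hypotheses of the object-level chain are jointly satisfiable over a genuine `p`-adic
field, and the one-place adelic datum built from it satisfies Thm. 9.11.1 and Cor. 9.11.1.1 as typed
(`padicAdelic_profile`). FRAMING: bookkeeping + standard mathematics; nothing of Joshi's is asserted; typed ≠ proved; no
side taken on [IUTchIII] Cor. 3.12 or on any author.
-/

noncomputable section

namespace Summit.ABC.IUTFork.Joshi.LogVol

open MeasureTheory

/-! ## (1) The adelic assembly from per-place scaling data -/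

section Adelic

variable {lstar : ℕ} {W : Type} [Fintype W] {E : W → Fin lstar → Type*} [∀ w i, Field (E w i)]
  [∀ w i, MeasurableSpace (E w i)] {X : W → Type*} [∀ w, MeasurableSpace (X w)]
  (Dw : ∀ w, ScalingDatum lstar (E w) (X w))

/-- **The adelic locus datum of a family of per-place scaling data** (Thm. 9.11.1 proof, p.127 l.56–65: «weighted
volumes are defined multiplicatively, one may work with components Θ̃^𝓘_{Mochizuki,w} for each w … and then take product
over all w»): place by place the projection `toLocusDatum` onto E-t4's carrier. [claim: Joshi2024ATS3, status: disputed] -/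
def adelicLocusDatum : ATS3.AdelicLocusDatum lstar W where
  loc w := (Dw w).toLocusDatum

/-- The component at `w` of the assembled adelic datum is the projection of the `w`-th scaling datum. [folklore] -/
theorem adelicLocusDatum_loc (w : W) : (adelicLocusDatum Dw).loc w = (Dw w).toLocusDatum := rfl

/-- **Thm. 9.11.1 AS PRINTED (adelic product), from per-place object-level inputs**: (9.9.2)–(9.9.3) and (9.9.4) at
every `w` suffice — Lem. 9.10.7.1 is discharged at every place by the typed §9.10 objects (p429037), and E-t4's adelic
spine `AdelicLocusDatum.fundamentalEstimateVol_of` (p428048) takes the product. [claim: Joshi2024ATS3, status: disputed] -/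
theorem adelic_fundamentalEstimateVol_of_inputs (h1 : ∀ w, (Dw w).NormLogBK)
    (h2 : ∀ w, (Dw w).RootScaling (ATS3.LocusDatum.scalingExponent lstar)) :
    (adelicLocusDatum Dw).FundamentalEstimateVol :=
  (adelicLocusDatum Dw).fundamentalEstimateVol_of (fun w => (Dw w).valuationScaling_of (h1 w) (h2 w))
    fun w => (Dw w).toExhibitedDatum.hullVolumeLowerBound_toLocusDatum

/-- **Cor. 9.11.1.1 AS PRINTED (Joshi's «[IUTchIII] Corollary 3.12», volume level), from per-place object-level inputs**
and the sign convention at every place. [claim: Joshi2024ATS3, status: disputed] -/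
theorem adelic_cor91111_of_inputs (h1 : ∀ w, (Dw w).NormLogBK)
    (h2 : ∀ w, (Dw w).RootScaling (ATS3.LocusDatum.scalingExponent lstar))
    (h3 : ∀ w, (Dw w).toLocusDatum.LogVolNonpos) : (adelicLocusDatum Dw).Cor91111 :=
  (adelicLocusDatum Dw).cor91111_of_inputs (fun w => (Dw w).valuationScaling_of (h1 w) (h2 w))
    (fun w => (Dw w).toExhibitedDatum.hullVolumeLowerBound_toLocusDatum) h3

end Adelic

/-! ## (2) A `ℚ_p` inhabitant of the full input signature -/

section Padic

variable (p : ℕ) [Fact p.Prime] [MeasurableSpace ℚ_[p]] [BorelSpace ℚ_[p]]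

/-- The one-factor `ℚ_p` exhibited datum (p430954: `τ = p`, locus `pℤ_p`, `|q^{1/2ℓ}| = p⁻¹`) extended to a `ScalingDatum`:
Tate-parameter root `q^{1/2ℓ} := p`, locus norms `{p⁻¹}`, tensor norm `p⁻¹`. [folklore] -/
def padicScalingDatum : ScalingDatum 1 (fun _ => ℚ_[p]) ℚ_[p] where
  toExhibitedDatum := padicExhibitedDatum p
  qrt := fun _ => (p : ℚ_[p])
  locusNorms := {(p : ℝ)⁻¹}
  locusNorms_bdd := bddAbove_singleton
  supNorm_eq := (csSup_singleton _).symm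
  tensorNorm := (p : ℝ)⁻¹
  tensorNorm_mem := rfl

/-- **Non-vacuity of the inputs of p429684 over `ℚ_p`**: `NormLogBK`, `RootScaling scalingExponent` and `CrossNorm` all HOLD at
`padicScalingDatum` (one label: `|τ| = |q^{1/2ℓ}| = ‖p‖_p = p⁻¹ = (p⁻¹)^{(1/1)²}`, `|⊗τ| = p⁻¹ = ∏ |τ_j|`). [folklore] -/
theorem padicScalingDatum_inputs :
    (padicScalingDatum p).NormLogBK ∧
      (padicScalingDatum p).RootScaling (ATS3.LocusDatum.scalingExponent 1) ∧ (padicScalingDatum p).CrossNorm := by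
  refine ⟨fun _ => rfl, fun i => ?_, ?_⟩
  · change (padicVolumeDatum p).abs (p : ℚ_[p]) = ((p : ℝ)⁻¹) ^ ATS3.LocusDatum.scalingExponent 1 i
    rw [padicVolumeDatum_abs, Padic.norm_p, ATS3.LocusDatum.scalingExponent, Fin.val_eq_zero i]
    norm_num
  · change ((p : ℝ)⁻¹) = ∏ _i : Fin 1, (padicVolumeDatum p).abs (p : ℚ_[p])
    rw [Fin.prod_univ_one, padicVolumeDatum_abs, Padic.norm_p]

/-- The one-place adelic datum over `ℚ_p` (index set `Fin 1`). [folklore] -/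
def padicAdelic : ATS3.AdelicLocusDatum 1 (Fin 1) := adelicLocusDatum fun _ => padicScalingDatum p

/-- **At the `ℚ_p` one-place adelic datum, Thm. 9.11.1 and Cor. 9.11.1.1 (as typed by E-t4) HOLD**, obtained through the
object-level chain from inputs that are THEOREMS there (`padicScalingDatum_inputs`) plus the sign convention
`Vol(pℤ_p) = p⁻¹ ≤ 1`. Non-vacuity of the assembled §9.9–§9.11 chain over a genuine `p`-adic field. [folklore] -/
theorem padicAdelic_profile : (padicAdelic p).FundamentalEstimateVol ∧ (padicAdelic p).Cor91111 := by
  obtain ⟨h1, h2, -⟩ := padicScalingDatum_inputs p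
  have h3 : (padicScalingDatum p).toLocusDatum.LogVolNonpos := (padicExhibitedDatum_profile p).2.2.2
  exact ⟨adelic_fundamentalEstimateVol_of_inputs (fun _ => padicScalingDatum p) (fun _ => h1) (fun _ => h2),
    adelic_cor91111_of_inputs (fun _ => padicScalingDatum p) (fun _ => h1) (fun _ => h2) fun _ => h3⟩

end Padic

end Summit.ABC.IUTFork.Joshi.LogVol

end
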